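import Summits.KontsevichZagierPeriods.KontsevichZagierPeriods.Theorems.RootDecompRelativeModAbsoluteCylLogSplitP49

/-! # `RootDecompRelativeModAbsoluteCylLogSplitP50` — part 25/27 of the mechanical ≤400-line split of `RungClosure.lean` (sha256 f909f334226f0fb5…)
Source: decomp-kz lens-3 g12 `RungClosure.lean` v9 (HOME/decomp-kz-lens-3/g12/, sha256 f909f334…; critic g4-52/g4-57/g5 CLEARED, «lander: split v9 --supports 30572»): BLOCK I (57 g11 monolith decls missing from P01–P25), BLOCK II/III (WildCertAssembly parts 1–6, 8–10: `Leaf.cellLocalWildCert`, `Leaf.cylKernelZeroLog_of_trees`), Parts 12–13 (`Leaf.regKernelPairDegOne_iff_circlePos_of_trees`), BLOCK G13 (Möbius engine, test §C decided).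
Split by census-1 g9 `gen/splitlean.py`: scopes re-opened with their `open`/`variable`/`set_option` context; mathematics and declaration order unchanged. -/

noncomputable section
open MeasureTheory Set
open Literature.NumberTheory.Transcendental Literature.ModelTheory.ExponentialFields
namespace Summit.KontsevichZagierPeriods.RootDecompRelativeModAbsolute.Rung30571.RegularisedLogLayer.CylLog.Leaf.G13

/-- Auxiliary step `reciprocal_mem_relations`: reciprocal mem relations. [bookkeeping] -/
theorem reciprocal_mem_relations {m : ℕ} {G : Set (Fin m → ℝ)} {u p : (Fin m → ℝ) → ℝ}
    (ru ri r1 : KZ.IntegralRep (m + 1)) (hG : IsSemialgebraic ℚ G) (hu : IsSemialgebraicFunOn ℚ G u)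
    (h1 : ∀ y ∈ G, 1 ≤ u y)
    (hd : ∀ z ∈ r1.domain, DifferentiableAt ℝ (fun w : Fin (m + 1) → ℝ => u (Fin.init w)) z)
    (hru : ru.domain = KZlog.band G (fun _ => 0) u)
    (hri : ri.domain = KZlog.band G (fun _ => 0) (fun y => 1 / u y))
    (hr1 : r1.domain = KZlog.band G (fun _ => 0) (fun _ => 1))
    (hiu : ru.integrand = fun z => p (Fin.init z) / (1 + z (Fin.last m) ^ 2))
    (hii : ri.integrand = fun z => p (Fin.init z) / (1 + z (Fin.last m) ^ 2))
    (hi1 : r1.integrand = fun z => p (Fin.init z) / (1 + z (Fin.last m) ^ 2)) :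
    KZ.of ru + KZ.of ri - KZ.of r1 - KZ.of r1 ∈ KZ.relations := by
  have hu0 : ∀ y ∈ G, 0 < u y := fun y hy => one_pos.trans_le (h1 y hy)
  have hk0 : ∀ y ∈ G, 0 ≤ mobK u y := fun y hy => by
    have := h1 y hy; unfold mobK; exact div_nonneg (by linarith) (by linarith)
  have hk1 : ∀ y ∈ G, mobK u y < 1 := fun y hy => by
    have := h1 y hy; unfold mobK; rw [div_lt_one (by linarith)]; linarith
  have hinv1 : ∀ y ∈ G, 1 / u y ≤ 1 := fun y hy => by rw [div_le_one (hu0 y hy)]; exact h1 y hy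
  have hinv0 : ∀ y ∈ G, 0 ≤ 1 / u y := fun y hy => by have := hu0 y hy; positivity
  -- semialgebraicity of the edges and of the Möbius parameter
  have h1sa : IsSemialgebraicFunOn ℚ G (fun _ => (1:ℝ)) := (isSemialgebraicFunOn_ratCast hG 1).congr fun _ _ => by simp
  have h0sa : IsSemialgebraicFunOn ℚ G (fun _ => (0:ℝ)) := (isSemialgebraicFunOn_ratCast hG 0).congr fun _ _ => by simp
  have hinvsa : IsSemialgebraicFunOn ℚ G (fun y => 1 / u y) :=
    IsSemialgebraicFunOn.div h1sa hu fun y hy => (hu0 y hy).ne'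
  have hksa : IsSemialgebraicFunOn ℚ G (mobK u) :=
    IsSemialgebraicFunOn.div ((IsSemialgebraicFunOn.sub_holds hu (isSemialgebraicFunOn_ratCast hG 1)).congr
        fun _ _ => by simp)
      ((IsSemialgebraicFunOn.add_holds hu (isSemialgebraicFunOn_ratCast hG 1)).congr fun _ _ => by simp)
      fun y hy => by have := hu0 y hy; positivity
  -- the four pieces: `A1 = ru ∣ [0,1]`, `B = ru ∣ [1,u]`, `Ai = r1 ∣ [0,u⁻¹]`, `B' = r1 ∣ [u⁻¹,1]`
  have hE1 : IsSemialgebraic ℚ (KZlog.band G (fun _ => (0:ℝ)) (fun _ => 1)) := KZlog.isSemialgebraic_band h0sa h1sa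
  have hEB : IsSemialgebraic ℚ (KZlog.band G (fun _ => (1:ℝ)) u) := KZlog.isSemialgebraic_band h1sa hu
  have hEi : IsSemialgebraic ℚ (KZlog.band G (fun _ => (0:ℝ)) (fun y => 1 / u y)) :=
    KZlog.isSemialgebraic_band h0sa hinvsa
  have hEB' : IsSemialgebraic ℚ (KZlog.band G (fun y => 1 / u y) (fun _ => 1)) :=
    KZlog.isSemialgebraic_band hinvsa h1sa
  have hsub1 : KZlog.band G (fun _ => (0:ℝ)) (fun _ => 1) ⊆ ru.domain := fun z hz => by
    rw [hru]; exact ⟨hz.1, hz.2.1, hz.2.2.trans (h1 _ hz.1)⟩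
  have hsubB : KZlog.band G (fun _ => (1:ℝ)) u ⊆ ru.domain := fun z hz => by
    rw [hru]; exact ⟨hz.1, zero_le_one.trans hz.2.1, hz.2.2⟩
  have hsubi : KZlog.band G (fun _ => (0:ℝ)) (fun y => 1 / u y) ⊆ r1.domain := fun z hz => by
    rw [hr1]; exact ⟨hz.1, hz.2.1, hz.2.2.trans (hinv1 _ hz.1)⟩
  have hsubB' : KZlog.band G (fun y => 1 / u y) (fun _ => 1) ⊆ r1.domain := fun z hz => by
    rw [hr1]; exact ⟨hz.1, (hinv0 _ hz.1).trans hz.2.1, hz.2.2⟩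
  set A1 := ru.restrict _ hE1 hsub1 with hA1
  set B := ru.restrict _ hEB hsubB with hB
  set Ai := r1.restrict _ hEi hsubi with hAi
  set B' := r1.restrict _ hEB' hsubB' with hB'
  -- (1) split `ru` at `t = 1`
  have S1 : KZ.of ru - KZ.of A1 - KZ.of B ∈ KZ.relations := by
    refine KZ.domainAddRel_subset_relations ⟨m + 1, ru, A1, B, ?_, ?_, fun _ _ => rfl, fun _ _ => rfl, rfl⟩
    · rw [hru]
      show _ = KZlog.band G (fun _ => (0:ℝ)) (fun _ => 1) ∪ KZlog.band G (fun _ => (1:ℝ)) u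
      ext z
      simp only [KZlog.mem_band, mem_union]
      constructor
      · rintro ⟨hy, h0, hu'⟩
        rcases le_total (z (Fin.last m)) 1 with h | h
        · exact Or.inl ⟨hy, h0, h⟩
        · exact Or.inr ⟨hy, h, hu'⟩
      · rintro (⟨hy, h0, h1'⟩ | ⟨hy, h1', hu'⟩)
        · exact ⟨hy, h0, h1'.trans (h1 _ hy)⟩
        · exact ⟨hy, zero_le_one.trans h1', hu'⟩
    · exact measure_mono_null (fun z hz => le_antisymm hz.1.2.2 hz.2.2.1) (KZ.volume_setOf_last_eq_zero (n := m) 1)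
  have C1 : KZ.of A1 - KZ.of r1 ∈ KZ.relations :=
    KZ.of_sub_of_mem_relations_of_eqOn (by rw [hr1]; rfl) fun z _ => by
      show ru.integrand z = r1.integrand z
      rw [hiu, hi1]
  -- (2) split `r1` at `t = u⁻¹`
  have S2 : KZ.of r1 - KZ.of Ai - KZ.of B' ∈ KZ.relations := by
    refine KZ.domainAddRel_subset_relations ⟨m + 1, r1, Ai, B', ?_, ?_, fun _ _ => rfl, fun _ _ => rfl, rfl⟩
    · rw [hr1]
      show _ = KZlog.band G (fun _ => (0:ℝ)) (fun y => 1 / u y) ∪ KZlog.band G (fun y => 1 / u y) (fun _ => 1)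
      ext z
      simp only [KZlog.mem_band, mem_union]
      constructor
      · rintro ⟨hy, h0, hu'⟩
        rcases le_total (z (Fin.last m)) (1 / u (Fin.init z)) with h | h
        · exact Or.inl ⟨hy, h0, h⟩
        · exact Or.inr ⟨hy, h, hu'⟩
      · rintro (⟨hy, h0, h1'⟩ | ⟨hy, h1', hu'⟩)
        · exact ⟨hy, h0, h1'.trans (hinv1 _ hy)⟩
        · exact ⟨hy, (hinv0 _ hy).trans h1', hu'⟩
    · refine measure_mono_null (fun z hz => ?_) (KZ.volume_graph_eq_zero (u := fun y => 1 / u y) hinvsa)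
      exact ⟨hz.1.1, le_antisymm hz.1.2.2 hz.2.2.1⟩
  have C2 : KZ.of Ai - KZ.of ri ∈ KZ.relations :=
    KZ.of_sub_of_mem_relations_of_eqOn (by rw [hri]; rfl) fun z _ => by
      show r1.integrand z = ri.integrand z
      rw [hi1, hii]
  -- (3) the Möbius rotation `B' → B`
  have M : KZ.of B' - KZ.of B ∈ KZ.relations := by
    have he₁ : ∀ y ∈ G, (1 / u y + mobK u y) / (1 - mobK u y * (1 / u y)) = 1 := by
      intro y hy
      have hU := hu0 y hy; have hU1 := h1 y hy
      have hne : u y ≠ 0 := hU.ne'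
      have hne1 : u y + 1 ≠ 0 := by positivity
      have hlt : mobK u y * (1 / u y) < 1 := by
        have hk := hk1 y hy; have hk0' := hk0 y hy
        calc mobK u y * (1 / u y) ≤ mobK u y * 1 := by gcongr; exact hinv1 y hy
          _ < 1 := by linarith
      rw [div_eq_one_iff_eq (by linarith)]
      simp only [mobK]
      field_simp
      ring
    have he₂ : ∀ y ∈ G, (1 + mobK u y) / (1 - mobK u y * 1) = u y := by
      intro y hy
      have hU := hu0 y hy
      have hne1 : u y + 1 ≠ 0 := by positivity
      have hk := hk1 y hy
      rw [mul_one, div_eq_iff (by linarith)]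
      simp only [mobK]
      field_simp
      ring
    have hr' : B.domain = KZlog.band G
        (fun y => (((fun y : Fin m → ℝ => 1 / u y) y) + mobK u y) / (1 - mobK u y * (fun y : Fin m → ℝ => 1 / u y) y))
        (fun y => (((fun _ : Fin m → ℝ => (1:ℝ)) y) + mobK u y) / (1 - mobK u y * (fun _ : Fin m → ℝ => (1:ℝ)) y)) := by
      ext z
      show z ∈ KZlog.band G (fun _ => (1:ℝ)) u ↔ _
      simp only [KZlog.mem_band]
      constructor
      · rintro ⟨hy, h1', h2⟩
        exact ⟨hy, by rw [he₁ _ hy]; exact h1', by rw [he₂ _ hy]; exact h2⟩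
      · rintro ⟨hy, h1', h2⟩
        exact ⟨hy, by rw [he₁ _ hy] at h1'; exact h1', by rw [he₂ _ hy] at h2; exact h2⟩
    refine of_sub_of_mem_relations_mobius (p := p) (k := mobK u) B' B rfl hr' hinv1 hksa ?_ ?_ ?_ ?_
    · intro z hz
      have hz' : z ∈ r1.domain := hsubB' hz
      have hne : u (Fin.init z) + 1 ≠ 0 := by have := hu0 _ hz.1; positivity
      have h : DifferentiableAt ℝ (fun w : Fin (m + 1) → ℝ => (u (Fin.init w) - 1) * (u (Fin.init w) + 1)⁻¹) z :=
        ((hd z hz').sub_const 1).mul (((hd z hz').add_const 1).inv hne)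
      simpa only [mobK, div_eq_mul_inv] using h
    · intro z hz
      have hk1' := hk1 _ hz.1; have hk0' := hk0 _ hz.1
      have ht : z (Fin.last m) ≤ 1 := hz.2.2
      nlinarith
    · show r1.integrand = _; exact hi1
    · show ru.integrand = _; exact hiu
  have key : KZ.of ru + KZ.of ri - KZ.of r1 - KZ.of r1 =
      (KZ.of ru - KZ.of A1 - KZ.of B) + (KZ.of A1 - KZ.of r1) - (KZ.of r1 - KZ.of Ai - KZ.of B')
        - (KZ.of Ai - KZ.of ri) - (KZ.of B' - KZ.of B) := by abel
  rw [key]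
  exact sub_mem (sub_mem (sub_mem (add_mem S1 C1) S2) C2) M

/-! ## Test §C — the STANDING CIRCLE TEST (g13 first rung)

Base `G = (0,1)`, `u = 1 + x ∈ (1,2)`; data of the pure positive circle kind (`q = 3`, `M = 0`, `e = 2`):
`c = (u, 1/u, −2)`, `κ = (u², 1/u², 1)`, `a₀ = 0`.  The fibre identity is
`u·(arctan u)/u + u⁻¹·(arctan u⁻¹)/u⁻¹ − 2·arctan 1 = arctan u + arctan(1/u) − π/2 = 0`, a genuine ANGLE relation
(circle units `w(u)·w(1/u)·w(1)⁻² = 1`).  `TestC.of_mem_relations` proves `[V] ∈ KZ.relations` for every honest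
representation `V` of this cylinder integral by KZ moves: two affine fibred substitutions `t = θu`, `t = θ/u`
(arctangent monomials `A_u = [{0 ≤ t ≤ u}, dt/(1+t²)]`, `A_{1/u}`), two fibre splits, and ONE MÖBIUS ROTATION
`[{1/u ≤ s ≤ 1}] ≡ [{1 ≤ t ≤ u}]` (`k = (u−1)/(u+1)`), i.e. `A_u + A_{1/u} ≡ 2·A_1`. -/

namespace TestC

open DegenerateInstance

/-- `u = 1 + x`. -/
def u (y : Fin 1 → ℝ) : ℝ := 1 + y 0

/-- Auxiliary step `u_pos`: u pos. [bookkeeping] -/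
theorem u_pos {y : Fin 1 → ℝ} (hy : y ∈ G) : 0 < u y := by have := hy.1; simp only [u]; linarith
/-- Auxiliary step `one_lt_u`: one lt u. [bookkeeping] -/
theorem one_lt_u {y : Fin 1 → ℝ} (hy : y ∈ G) : 1 < u y := by have := hy.1; simp only [u]; linarith
/-- Auxiliary step `u_lt_two`: u lt two. [bookkeeping] -/
theorem u_lt_two {y : Fin 1 → ℝ} (hy : y ∈ G) : u y < 2 := by have := hy.2; simp only [u]; linarith
/-- Auxiliary step `sa_u`: sa u. [bookkeeping] -/
theorem sa_u : IsSemialgebraicFunOn ℚ G u := MixedInstance.sa_one_add.congr fun _ _ => rfl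
/-- Auxiliary step `sa_inv_u`: sa inv u. [bookkeeping] -/
theorem sa_inv_u : IsSemialgebraicFunOn ℚ G (fun y => 1 / u y) :=
  IsSemialgebraicFunOn.div ((isSemialgebraicFunOn_ratCast isSemialgebraic_G 1).congr fun _ _ => by simp) sa_u
    fun y hy => (u_pos hy).ne'
/-- Auxiliary step `sa_const`: sa const. [bookkeeping] -/
theorem sa_const (q : ℚ) : IsSemialgebraicFunOn ℚ G (fun _ => (q : ℝ)) := isSemialgebraicFunOn_ratCast isSemialgebraic_G q
/-- Auxiliary step `sa_zero`: sa zero. [bookkeeping] -/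
theorem sa_zero : IsSemialgebraicFunOn ℚ G (fun _ => (0 : ℝ)) := (sa_const 0).congr fun _ _ => by simp
/-- Auxiliary step `sa_one`: sa one. [bookkeeping] -/
theorem sa_one : IsSemialgebraicFunOn ℚ G (fun _ => (1 : ℝ)) := (sa_const 1).congr fun _ _ => by simp
/-- the rotation parameter `k = (u − 1)/(u + 1)`. -/
def k (y : Fin 1 → ℝ) : ℝ := (u y - 1) / (u y + 1)
/-- Auxiliary step `sa_k`: sa k. [bookkeeping] -/
theorem sa_k : IsSemialgebraicFunOn ℚ G k :=
  IsSemialgebraicFunOn.div ((IsSemialgebraicFunOn.sub_holds sa_u (sa_const 1)).congr fun _ _ => by simp)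
    ((IsSemialgebraicFunOn.add_holds sa_u (sa_const 1)).congr fun _ _ => by simp)
    fun y hy => by have := u_pos hy; positivity
/-- Auxiliary step `k_nonneg`: k nonneg. [bookkeeping] -/
theorem k_nonneg {y : Fin 1 → ℝ} (hy : y ∈ G) : 0 ≤ k y := by
  have := one_lt_u hy; simp only [k]; exact div_nonneg (by linarith) (by linarith)
/-- Auxiliary step `k_lt_one`: k lt one. [bookkeeping] -/
theorem k_lt_one {y : Fin 1 → ℝ} (hy : y ∈ G) : k y < 1 := by
  have := one_lt_u hy; simp only [k]; rw [div_lt_one (by linarith)]; linarith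

/-- bands over `G` with edges in `[0, 2]` lie in a box. -/
theorem band_subset_Icc' {a b : (Fin 1 → ℝ) → ℝ} (h0 : ∀ y ∈ G, 0 ≤ a y) (h2 : ∀ y ∈ G, b y ≤ 2) :
    KZlog.band G a b ⊆ Icc (0 : Fin (1 + 1) → ℝ) (fun _ => 2) := by
  intro z hz
  obtain ⟨hy, h1, h3⟩ := hz
  rw [mem_Icc, Pi.le_def, Pi.le_def]
  refine ⟨fun i => ?_, fun i => ?_⟩
  · rcases Fin.eq_castSucc_or_eq_last i with ⟨j, rfl⟩ | rfl
    · rw [Fin.eq_zero j]; exact (show 0 < Fin.init z 0 from hy.1).le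
    · exact (h0 _ hy).trans h1
  · rcases Fin.eq_castSucc_or_eq_last i with ⟨j, rfl⟩ | rfl
    · rw [Fin.eq_zero j]; exact ((show Fin.init z 0 < 1 from hy.2).trans one_lt_two).le
    · exact h3.trans (h2 _ hy)

/-- Auxiliary step `volume_band_lt_top'`: volume band lt top'. [bookkeeping] -/
theorem volume_band_lt_top' {a b : (Fin 1 → ℝ) → ℝ} (h0 : ∀ y ∈ G, 0 ≤ a y) (h2 : ∀ y ∈ G, b y ≤ 2) :
    volume (KZlog.band G a b) < ⊤ :=
  lt_of_le_of_lt (measure_mono (band_subset_Icc' h0 h2)) isCompact_Icc.measure_lt_top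

/-- An honest representation over a band of `G` with a bounded `ℚ`-sa integrand. -/
def bandRep (a b : (Fin 1 → ℝ) → ℝ) (f : (Fin (1 + 1) → ℝ) → ℝ) (ha : IsSemialgebraicFunOn ℚ G a)
    (hb : IsSemialgebraicFunOn ℚ G b) (h0 : ∀ y ∈ G, 0 ≤ a y) (h2 : ∀ y ∈ G, b y ≤ 2)
    (hf : IsSemialgebraicFunOn ℚ (KZlog.band G a b) f) (K : ℝ) (hK : ∀ z ∈ KZlog.band G a b, |f z| ≤ K) :
    KZ.IntegralRep (1 + 1) :=
  ⟨KZlog.band G a b, f, KZlog.isSemialgebraic_band ha hb, hf,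
    integrableOn_of_abs_le (KZlog.isSemialgebraic_band ha hb) (volume_band_lt_top' h0 h2) hf K hK⟩

/-- Auxiliary step `bandRep_domain`: band Rep domain. [bookkeeping] -/
@[simp] theorem bandRep_domain (a b : (Fin 1 → ℝ) → ℝ) (f : (Fin (1 + 1) → ℝ) → ℝ) (ha hb h0 h2 hf K hK) :
    (bandRep a b f ha hb h0 h2 hf K hK).domain = KZlog.band G a b := rfl
/-- Auxiliary step `bandRep_integrand`: band Rep integrand. [bookkeeping] -/
@[simp] theorem bandRep_integrand (a b : (Fin 1 → ℝ) → ℝ) (f : (Fin (1 + 1) → ℝ) → ℝ) (ha hb h0 h2 hf K hK) :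
    (bandRep a b f ha hb h0 h2 hf K hK).integrand = f := rfl

/-- the circle kernel `p(x)/(1 + t² w(x))` is `ℚ`-sa on bands. -/
theorem sa_kernelC {B : Set (Fin (1 + 1) → ℝ)} (hB : IsSemialgebraic ℚ B) (hBG : B ⊆ {z | Fin.init z ∈ G})
    {p w : (Fin 1 → ℝ) → ℝ} (hp : IsSemialgebraicFunOn ℚ G p) (hw : IsSemialgebraicFunOn ℚ G w)
    (hw0 : ∀ y ∈ G, 0 ≤ w y) :
    IsSemialgebraicFunOn ℚ B (fun z => p (Fin.init z) / (1 + z (Fin.last 1) ^ 2 * w (Fin.init z))) := by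
  have hT : IsSemialgebraicFunOn ℚ B (fun z => z (Fin.last 1)) :=
    Literature.NumberTheory.Transcendental.isSemialgebraicFunOn_apply hB (Fin.last 1)
  have hden : IsSemialgebraicFunOn ℚ B (fun z => 1 + z (Fin.last 1) ^ 2 * w (Fin.init z)) :=
    (IsSemialgebraicFunOn.add_holds (isSemialgebraicFunOn_ratCast hB 1)
      (IsSemialgebraicFunOn.mul_holds (isSemialgebraicFunOn_pow' hB hT 2) (hw.comp_init_mono hB hBG))).congr
      fun _ _ => by simp
  refine IsSemialgebraicFunOn.div (hp.comp_init_mono hB hBG) hden fun z hz => ?_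
  have := hw0 _ (hBG hz)
  positivity

/-- the arctangent kernel `p(x)/(1 + t²)` is `ℚ`-sa on bands. -/
theorem sa_kernelA {B : Set (Fin (1 + 1) → ℝ)} (hB : IsSemialgebraic ℚ B) (hBG : B ⊆ {z | Fin.init z ∈ G})
    {p : (Fin 1 → ℝ) → ℝ} (hp : IsSemialgebraicFunOn ℚ G p) :
    IsSemialgebraicFunOn ℚ B (fun z => p (Fin.init z) / (1 + z (Fin.last 1) ^ 2)) :=
  (sa_kernelC hB hBG hp sa_one fun _ _ => zero_le_one).congr fun _ _ => by simp

/-- Auxiliary step `abs_kernelC_le`: abs kernel C le. [bookkeeping] -/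
theorem abs_kernelC_le {p w t : ℝ} (hw : 0 ≤ w) : |p / (1 + t ^ 2 * w)| ≤ |p| := by
  have hd : 0 < 1 + t ^ 2 * w := by positivity
  rw [abs_div, abs_of_pos hd]
  exact div_le_self (abs_nonneg _) (le_add_of_nonneg_right (by positivity))

/-- Auxiliary step `abs_kernelA_le`: abs kernel A le. [bookkeeping] -/
theorem abs_kernelA_le {p t : ℝ} : |p / (1 + t ^ 2)| ≤ |p| := by
  simpa using (abs_kernelC_le (p := p) (t := t) zero_le_one)

/-- Auxiliary step `band_sa`: band sa. [bookkeeping] -/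
theorem band_sa {a b : (Fin 1 → ℝ) → ℝ} (ha : IsSemialgebraicFunOn ℚ G a) (hb : IsSemialgebraicFunOn ℚ G b) :
    IsSemialgebraic ℚ (KZlog.band G a b) := KZlog.isSemialgebraic_band ha hb
/-- Auxiliary step `band_sub`: band sub. [bookkeeping] -/
theorem band_sub {a b : (Fin 1 → ℝ) → ℝ} : KZlog.band G a b ⊆ {z : Fin (1 + 1) → ℝ | Fin.init z ∈ G} :=
  fun _ hz => hz.1

/-! ### the eleven representations -/

/-- the three closed-form summands of the test integrand -/
def f₁ (z : Fin (1 + 1) → ℝ) : ℝ := u (Fin.init z) / (1 + z (Fin.last 1) ^ 2 * (u (Fin.init z) ^ 2))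
/-- Auxiliary definition `f₂`: f₂. [bookkeeping] -/
def f₂ (z : Fin (1 + 1) → ℝ) : ℝ := (1 / u (Fin.init z)) / (1 + z (Fin.last 1) ^ 2 * ((1 / u (Fin.init z)) ^ 2))
/-- Auxiliary definition `f₃`: f₃. [bookkeeping] -/
def f₃ (z : Fin (1 + 1) → ℝ) : ℝ := (-2 : ℝ) / (1 + z (Fin.last 1) ^ 2 * (1 : ℝ))
/-- the arctangent kernel and its negative -/
def gA (z : Fin (1 + 1) → ℝ) : ℝ := (1 : ℝ) / (1 + z (Fin.last 1) ^ 2)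
/-- Auxiliary definition `gN`: g N. [bookkeeping] -/
def gN (z : Fin (1 + 1) → ℝ) : ℝ := (-1 : ℝ) / (1 + z (Fin.last 1) ^ 2)

/-- Auxiliary step `sa_usq`: sa usq. [bookkeeping] -/
theorem sa_usq : IsSemialgebraicFunOn ℚ G (fun y => u y ^ 2) := isSemialgebraicFunOn_pow' isSemialgebraic_G sa_u 2
/-- Auxiliary step `sa_invusq`: sa invusq. [bookkeeping] -/
theorem sa_invusq : IsSemialgebraicFunOn ℚ G (fun y => (1 / u y) ^ 2) :=
  isSemialgebraicFunOn_pow' isSemialgebraic_G sa_inv_u 2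
/-- Auxiliary step `sa_m2`: sa m2. [bookkeeping] -/
theorem sa_m2 : IsSemialgebraicFunOn ℚ G (fun _ => (-2 : ℝ)) := (sa_const (-2)).congr fun _ _ => by simp
/-- Auxiliary step `sa_m1`: sa m1. [bookkeeping] -/
theorem sa_m1 : IsSemialgebraicFunOn ℚ G (fun _ => (-1 : ℝ)) := (sa_const (-1)).congr fun _ _ => by simp

/-- Auxiliary step `le0`: le0. [bookkeeping] -/
theorem le0 : ∀ y ∈ G, (0:ℝ) ≤ (fun _ : Fin 1 → ℝ => (0:ℝ)) y := fun _ _ => le_rfl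
/-- Auxiliary step `le1`: le1. [bookkeeping] -/
theorem le1 : ∀ y ∈ G, (fun _ : Fin 1 → ℝ => (1:ℝ)) y ≤ 2 := fun _ _ => by norm_num
/-- Auxiliary step `leu`: leu. [bookkeeping] -/
theorem leu : ∀ y ∈ G, u y ≤ 2 := fun _ hy => (u_lt_two hy).le
/-- Auxiliary step `leinv0`: leinv0. [bookkeeping] -/
theorem leinv0 : ∀ y ∈ G, (0:ℝ) ≤ (fun y => 1 / u y) y := fun _ hy => by have := u_pos hy; positivity
/-- Auxiliary step `leinv2`: leinv2. [bookkeeping] -/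
theorem leinv2 : ∀ y ∈ G, (fun y : Fin 1 → ℝ => 1 / u y) y ≤ 2 := fun _ hy => by
  have := one_lt_u hy
  show 1 / u _ ≤ 2
  rw [div_le_iff₀ (by linarith)]; linarith
/-- Auxiliary step `le1'`: le1'. [bookkeeping] -/
theorem le1' : ∀ y ∈ G, (0:ℝ) ≤ (fun _ : Fin 1 → ℝ => (1:ℝ)) y := fun _ _ => zero_le_one

end TestC
end Summit.KontsevichZagierPeriods.RootDecompRelativeModAbsolute.Rung30571.RegularisedLogLayer.CylLog.Leaf.G13
end
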